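import Literature.AnabelianGeometry.EtaleTheta.Discharge.Sec2ThetaOrbitClasses
import Literature.AnabelianGeometry.EtaleTheta.ThetaEnvOfSetting

/-!
# [EtTh] Prop 2.14 (ii) for the §1 model, II: the difference cocycle extends to `Π^tp_Y̲̲`
# (cocycle level)

Mochizuki, *The Étale Theta Function …* [EtTh], Publ. RIMS 45 (2009), §2, Prop 2.14 (ii), PRIMS PDF
p.49 (locators `p.N` = PDF pages; bib key `MochizukiEtTh2009`). PROOF-ONLY companion of
`ThetaEnvOfSetting.lean` (seat abc-iut-L2-t8); unit
"deep EtTh:Prop2.14(ii)-model (hgal)" of seat abc-iut-L2-t10; continuation of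
`Discharge/Sec2ThetaOrbitClasses.lean` (class level).

For the §1 model of `X̲̲` (`C : E.DoubleUnderline l` over `D : ThetaSetting p`), a root cocycle `f` of
`η̲̈^{Θ,l·ℤ×μ₂}` on `Π^tp_Ÿ̲̲` (`rootCocycles`, p.46) and `x ∈ Π^tp_X̲̲`, the difference `f · (x·f)⁻¹` — the
`l·Δ_Θ`-valued cocycle whose reduction mod `N` is the difference `δ = s^Θ − t^Θ` of Prop 2.14 (ii) for
the `Gal(Y̲̲/X̲̲)`-conjugate `t^Θ` — is shown, at the COCYCLE level, to

* `exists_descended_rep` — agree on `Π^tp_Ÿ̲̲` with `k ↦ m(k̄) · ∂e(k̄)` for a continuous cocycle `m` on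
  `(Π^tp_Y)^Θ` representing `b·log(U) + log(k)` and some `e ∈ Δ_Θ` ("`Ü²` descends to `Y`", p.49;
  from `conj_etaDd_div_eq`, i.e. Prop 1.5 (iii) + `K = K̈`);
* `lDelta_valued_of_restrict` — any continuous `Δ_Θ`-valued cocycle on `Π^tp_Y̲̲` that is
  `l·Δ_Θ`-valued on `Π^tp_Ÿ̲̲` is `l·Δ_Θ`-valued (`[Π^tp_Y̲̲ : Π^tp_Ÿ̲̲] = 2`, `l` odd, `Δ_Θ` central in `(Δ^tp_X)^Θ`,
  `Π^tp_Ÿ̲̲ ↠ G_K`) — so the extension reduces mod `N` through `(l·Δ_Θ) ↠ μ_N`;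
* `conjDiff_apply_eq_one_of_mem` / `cocycle_apply_mul_self_of_aug_eq_one` — for `y ∈ Π^tp_X̲̲` the cocycle
  `(y·F)·F⁻¹` of the extension `F` VANISHES on `Δ^tp_Ÿ̲̲` ("`Gal(Y/X)` maps `Ü²` to a `K^×`-multiple of
  `Ü²`", p.49; from `res_conj_descended_div_eq_one`, i.e. Prop 1.5 (ii)+(iii)) and squares to `1` on
  `Δ^tp_Y̲̲`.

HONEST FRAMING: conditional on t1's named facts `Prop15ii`, `Prop15iii` exactly as the printed proof
is on Prop 1.5 (ii), (iii); nothing else asserted; no side taken on [IUTchIII] Cor 3.12.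
-/

noncomputable section

namespace Literature.AnabelianGeometry.EtaleTheta

open Literature.AnabelianGeometry.SemiGraphs
open scoped IsMulCommutative

/-! ## Two more generic facts about the concrete `H¹` -/

namespace ContH1

variable {G G' : Type*} [Group G] [TopologicalSpace G] [IsTopologicalGroup G]
  [Group G'] [TopologicalSpace G'] [IsTopologicalGroup G']
  {A : Subgroup G'} [A.Normal] [IsMulCommutative A]
  {G₀ : Type*} [Group G₀] [TopologicalSpace G₀] [IsTopologicalGroup G₀]
  {ψ : G₀ →* G'} {hψ : Continuous ψ}

omit [IsTopologicalGroup G] in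
/-- Inflation commutes with conjugation already for cocycles (pointwise).
[cite: NeukirchSchmidtWingberg2008, I §5] -/
theorem inflCocycle_conjCocycle_apply {H₀ : Subgroup G₀} {H' : Subgroup G'} [H₀.Normal] [H'.Normal]
    (h : H₀.map ψ ≤ H') (τ : G₀) (f : contCocycles (MonoidHom.id G') A H') (k : H₀) :
    (conjCocycle ψ A τ (inflCocycle A ψ hψ h f)).1 k =
      (conjCocycle (MonoidHom.id G') A (ψ τ) f).1 ⟨ψ k, h ⟨k.1, k.2, rfl⟩⟩ := by
  have hAB : (MulAut.conjNormal (ψ τ)⁻¹ (⟨ψ (k : G₀), h ⟨k.1, k.2, rfl⟩⟩ : H') : H') =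
      ⟨ψ ((MulAut.conjNormal τ⁻¹ k : H₀) : G₀), h ⟨_, (MulAut.conjNormal τ⁻¹ k).2, rfl⟩⟩ := by
    apply Subtype.ext
    simp only [map_mul, map_inv, MulAut.conjNormal_inv_apply]
  calc (conjCocycle ψ A τ (inflCocycle A ψ hψ h f)).1 k
      = MulAut.conjNormal (ψ τ) (f.1 ⟨ψ ((MulAut.conjNormal τ⁻¹ k : H₀) : G₀),
          h ⟨_, (MulAut.conjNormal τ⁻¹ k).2, rfl⟩⟩) := rfl
    _ = MulAut.conjNormal (ψ τ) (f.1 (MulAut.conjNormal (ψ τ)⁻¹ ⟨ψ (k : G₀), h ⟨k.1, k.2, rfl⟩⟩)) := by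
          rw [hAB]
    _ = (conjCocycle (MonoidHom.id G') A (ψ τ) f).1 ⟨ψ k, h ⟨k.1, k.2, rfl⟩⟩ := rfl

variable {φ : G →* G'} in
/-- The conjugate cocycle evaluated at `h`, with the conjugated point named.
[cite: NeukirchSchmidtWingberg2008, I §5] -/
theorem conjCocycle_apply_eq {H : Subgroup G} [H.Normal] (σ : G) (f : contCocycles φ A H) (h h' : H)
    (hh : (h' : G) = σ⁻¹ * h * σ) :
    (conjCocycle φ A σ f).1 h = MulAut.conjNormal (φ σ) (f.1 h') := by
  have : MulAut.conjNormal σ⁻¹ h = h' :=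
    Subtype.ext (by rw [hh, map_inv, MulAut.conjNormal_inv_apply])
  rw [conjCocycle_apply, this]

end ContH1

namespace ThetaSetting

variable {p : ℕ} [Fact p.Prime] {D : ThetaSetting p}

/-- `Δ^tp_X` acts trivially on `Δ_Θ` through `(Π^tp_X)^Θ` (`Δ_Θ` is central in `(Δ^tp_X)^Θ`, p.12): for
`g ∈ Π^tp_X` with `aug g = 1`, `ḡ e ḡ⁻¹ = e`. [cite: MochizukiEtTh2009, §1 p.12] -/
theorem conjNormal_eq_of_aug_eq_one {g : D.PiTemp} (hg : D.aug.toMonoidHom g = 1) (e : D.DeltaTheta) :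
    MulAut.conjNormal (D.toTheta g) e = e := by
  apply Subtype.ext
  rw [MulAut.conjNormal_apply]
  have := D.ker_thetaToEll_central (e : D.GtpTheta) e.2 (D.toTheta g) ⟨g, hg, rfl⟩
  rw [← this, mul_inv_cancel_right]

/-- The coboundary `∂e` vanishes at elements of `Δ^tp_X`. [cite: MochizukiEtTh2009, §1 p.12] -/
theorem cob_eq_one_of_aug_eq_one {g : D.PiTemp} (hg : D.aug.toMonoidHom g = 1) (e : D.DeltaTheta) :
    MulAut.conjNormal (D.toTheta g) e * e⁻¹ = 1 := by
  rw [conjNormal_eq_of_aug_eq_one hg, mul_inv_cancel]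

/-- `∂` is multiplicative in the element: `∂(a·b) = ∂a · ∂b` (`Δ_Θ` commutative).
[cite: MochizukiEtTh2009, Prop 2.14(ii) p.49] -/
theorem cob_mul (t : D.GtpTheta) (a b : D.DeltaTheta) :
    MulAut.conjNormal t (a * b) * (a * b)⁻¹ =
      (MulAut.conjNormal t a * a⁻¹) * (MulAut.conjNormal t b * b⁻¹) := by
  rw [map_mul, mul_inv]
  apply (Additive.ofMul : D.DeltaTheta ≃ _).injective
  simp only [ofMul_mul, ofMul_inv]
  abel

/-- `∂(a⁻¹) = (∂a)⁻¹`. [cite: MochizukiEtTh2009, Prop 2.14(ii) p.49] -/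
theorem cob_inv (t : D.GtpTheta) (a : D.DeltaTheta) :
    MulAut.conjNormal t a⁻¹ * a⁻¹⁻¹ = (MulAut.conjNormal t a * a⁻¹)⁻¹ := by
  rw [map_inv, inv_inv, mul_inv, inv_inv]

/-- Conjugating a coboundary: `x̄ · ∂a(x̄⁻¹ t x̄) · x̄⁻¹ = ∂(x̄ a x̄⁻¹)(t)`.
[cite: MochizukiEtTh2009, Prop 2.14(ii) p.49] -/
theorem conjNormal_cob (s t : D.GtpTheta) (a : D.DeltaTheta) :
    MulAut.conjNormal s (MulAut.conjNormal (s⁻¹ * t * s) a * a⁻¹) =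
      MulAut.conjNormal t (MulAut.conjNormal s a) * (MulAut.conjNormal s a)⁻¹ := by
  apply Subtype.ext
  simp only [MulAut.conjNormal_apply, Subgroup.coe_mul, Subgroup.coe_inv, mul_inv_rev, inv_inv]
  group

namespace EtaleThetaData.DoubleUnderline

variable {E : D.EtaleThetaData} {l : ℕ} (C : E.DoubleUnderline l)

/-! ## The extension of the difference cocycle -/

/-- `(Π^tp_Y̲̲)` (`= Π^tp_Y ∩ Π^tp_X̲̲` inside `Π^tp_X̲̲`) maps into `(Π^tp_Y)^Θ`. [cite: MochizukiEtTh2009, Def 2.13 p.47] -/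
theorem map_GtpYuu_le :
    (D.GtpY.subgroupOf C.Huu).map (D.toTheta.comp C.Huu.subtype) ≤ D.GtpY.map D.toTheta := by
  rintro _ ⟨g, hg, rfl⟩
  exact ⟨(g : D.PiTemp), Subgroup.mem_subgroupOf.1 hg, rfl⟩

/-- `Π^tp_Y̲̲` is normal in `Π^tp_X̲̲`. [cite: MochizukiEtTh2009, Def 2.13 p.47] -/
theorem GtpYuu_normal : (D.GtpY.subgroupOf C.Huu).Normal :=
  (inferInstanceAs D.toZ.ker.Normal : D.GtpY.Normal).subgroupOf C.Huu

/-- `x⁻¹ k x ∈ Π^tp_Ÿ` for `x ∈ Π^tp_X̲̲`, `k ∈ Π^tp_Ÿ̲̲` (`Π^tp_Ÿ` is normal in `Π^tp_X`).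
[cite: MochizukiEtTh2009, Def 2.13 p.46] -/
theorem inv_mul_mul_mem_GtpYdd (hC : D.Compat) (x : C.Huu) (k : C.GtpYdduu) :
    (x : D.PiTemp)⁻¹ * k * x ∈ D.GtpYdd := by
  simpa using hC.GtpYdd_normal.conj_mem _ (Subgroup.mem_inf.1 k.2).1 (x : D.PiTemp)⁻¹

/-- `x⁻¹ k x ∈ Π^tp_Ÿ̲̲` for `x ∈ Π^tp_X̲̲`, `k ∈ Π^tp_Ÿ̲̲`. [cite: MochizukiEtTh2009, Def 2.13 p.46] -/
theorem inv_mul_mul_mem_GtpYdduu (hC : D.Compat) (x : C.Huu) (k : C.GtpYdduu) :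
    (x : D.PiTemp)⁻¹ * k * x ∈ C.GtpYdduu :=
  Subgroup.mem_inf.2 ⟨C.inv_mul_mul_mem_GtpYdd hC x k,
    C.Huu.mul_mem (C.Huu.mul_mem (C.Huu.inv_mem x.2) (Subgroup.mem_inf.1 k.2).2) x.2⟩

/-- The coboundary `g ↦ ∂e(ḡ)` of `e ∈ Δ_Θ` is a continuous cocycle on `Π^tp_Y̲̲ ⊆ Π^tp_X̲̲`.
[cite: NeukirchSchmidtWingberg2008, I §2 and II §7] -/
theorem cob_mem_contCocycles (e : D.DeltaTheta) :
    (fun g : D.GtpY.subgroupOf C.Huu =>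
        MulAut.conjNormal (D.toTheta ((g : C.Huu) : D.PiTemp)) e * e⁻¹) ∈
      contCocycles (D.toTheta.comp C.Huu.subtype) D.DeltaTheta (D.GtpY.subgroupOf C.Huu) := by
  refine ⟨?_, fun g h => ?_⟩
  · have hc : Continuous fun g : D.GtpY.subgroupOf C.Huu =>
        (MulAut.conjNormal (D.toTheta ((g : C.Huu) : D.PiTemp)) e : D.DeltaTheta) :=
      continuous_induced_rng.2 (by
        simp only [Function.comp_def, MulAut.conjNormal_apply]
        exact ((D.continuous_toTheta.comp (continuous_subtype_val.comp continuous_subtype_val)).mul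
          continuous_const).mul
          (D.continuous_toTheta.comp (continuous_subtype_val.comp continuous_subtype_val)).inv)
    exact hc.mul continuous_const
  · change MulAut.conjNormal (D.toTheta (((g * h : D.GtpY.subgroupOf C.Huu) : C.Huu) : D.PiTemp)) e * e⁻¹ =
      MulAut.conjNormal (D.toTheta ((g : C.Huu) : D.PiTemp)) e * e⁻¹ *
        MulAut.conjNormal (D.toTheta ((g : C.Huu) : D.PiTemp))
          (MulAut.conjNormal (D.toTheta ((h : C.Huu) : D.PiTemp)) e * e⁻¹)
    rw [Subgroup.coe_mul, Subgroup.coe_mul]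
    simp only [map_mul, MulAut.mul_apply, map_inv]
    apply (Additive.ofMul : D.DeltaTheta ≃ _).injective
    simp only [ofMul_mul, ofMul_inv]
    abel

/-- **The difference cocycle is the restriction of a "descended" cocycle** ("`Ü²` descends to `Y`",
p.49): for a root cocycle `f` of `η̲̈^{Θ,l·ℤ×μ₂}` and `x ∈ Π^tp_X̲̲` there are a continuous cocycle `m` on
`(Π^tp_Y)^Θ` representing `b·log(U) + log(k)` (`b = ` image of `x` in `Z`, `k ∈ (K^×)^∧`) and `e ∈ Δ_Θ`
with `f(k) · (x·f)(k)⁻¹ = m(k̄) · ∂e(k̄)` for all `k ∈ Π^tp_Ÿ̲̲`, where `(x·f)(k) = x̄ f(x⁻¹ k x) x̄⁻¹`. From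
`conj_etaDd_div_eq` (Prop 1.5 (iii), `K = K̈`). [cite: MochizukiEtTh2009, Prop 2.14(ii) p.49] -/
theorem exists_descended_rep (hC : D.Compat) (hS : D.Sec2Hyps) (h15 : Prop15iii E hC)
    {f : contCocycles D.toTheta D.DeltaTheta C.GtpYdduu} (hf : f ∈ C.rootCocycles hC) (x : C.Huu) :
    ∃ (b : ℤ) (kk : E.KHat)
      (m : contCocycles (MonoidHom.id D.GtpTheta) D.DeltaTheta (D.GtpY.map D.toTheta))
      (e : D.DeltaTheta),
      (QuotientGroup.mk m : D.H1Theta (D.GtpY.map D.toTheta)) = E.logU ^ b * E.kumY kk ∧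
      ∀ k : C.GtpYdduu, f.1 k * (MulAut.conjNormal (D.toTheta (x : D.PiTemp))
          (f.1 ⟨(x : D.PiTemp)⁻¹ * k * x, C.inv_mul_mul_mem_GtpYdduu hC x k⟩))⁻¹ =
        m.1 ⟨D.toTheta (k : D.PiTemp), ⟨k, D.GtpYdd_le_GtpY k.2.1, rfl⟩⟩ *
          (MulAut.conjNormal (D.toTheta (k : D.PiTemp)) e * e⁻¹) := by
  haveI := hC.GtpYdd_normal
  obtain ⟨f₀, hf₀⟩ : ∃ f₀ : contCocycles D.toTheta D.DeltaTheta D.GtpYdd,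
      (QuotientGroup.mk f₀ : D.H1 D.GtpYdd) = E.etaDd := QuotientGroup.mk_surjective _
  obtain ⟨σ, hσmem, hclass⟩ := hf.2
  obtain ⟨kk, hQ⟩ := E.conj_etaDd_div_eq hC hS h15 σ (x : D.PiTemp)
  set b : ℤ := Multiplicative.toAdd (D.toZ (x : D.PiTemp)) with hb
  obtain ⟨m, hm⟩ : ∃ m : contCocycles (MonoidHom.id D.GtpTheta) D.DeltaTheta (D.GtpY.map D.toTheta),
      (QuotientGroup.mk m : D.H1Theta (D.GtpY.map D.toTheta)) = E.logU ^ b * E.kumY kk :=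
    QuotientGroup.mk_surjective _
  -- the two conjugates of `f₀` and the restricted inflation of `m`
  set g₁ := ContH1.conjCocycle D.toTheta D.DeltaTheta σ f₀ with hg₁
  set g₂ := ContH1.conjCocycle D.toTheta D.DeltaTheta ((x : D.PiTemp) * σ) f₀ with hg₂
  set r := ContH1.resCocycle D.toTheta D.DeltaTheta D.GtpYdd_le_GtpY
    (ContH1.inflCocycle D.DeltaTheta D.toTheta D.continuous_toTheta le_rfl m) with hr
  -- `f = (σ·f₀)|_{Ÿ̲̲} · ∂c₁` (the class of `f` lies in the orbit, p.41)
  have hclass' : (QuotientGroup.mk (ContH1.resCocycle D.toTheta D.DeltaTheta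
      (inf_le_left : C.GtpYdduu ≤ D.GtpYdd) g₁) : D.H1 C.GtpYdduu) = QuotientGroup.mk f := by
    change ContH1.res D.toTheta D.DeltaTheta inf_le_left
      (ContH1.conj D.toTheta D.DeltaTheta σ (QuotientGroup.mk f₀)) = _
    rw [hf₀]
    exact hclass.symm
  obtain ⟨c₁, hσ⟩ := ContH1.exists_coboundary_of_mk_eq _ f hclass'
  -- the class identity `hQ` at the level of cocycles on `Π^tp_Ÿ`
  have hQ' : (QuotientGroup.mk r : D.H1 D.GtpYdd) = QuotientGroup.mk (g₁ * g₂⁻¹) := by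
    have h1 : (QuotientGroup.mk (g₁ * g₂⁻¹) : D.H1 D.GtpYdd) =
        ContH1.conj D.toTheta D.DeltaTheta σ E.etaDd *
          (ContH1.conj D.toTheta D.DeltaTheta ((x : D.PiTemp) * σ) E.etaDd)⁻¹ := by
      rw [← hf₀]; rfl
    have h2 : (QuotientGroup.mk r : D.H1 D.GtpYdd) = ContH1.res D.toTheta D.DeltaTheta D.GtpYdd_le_GtpY
        (D.inflTheta D.GtpY (E.logU ^ b * E.kumY kk)) := by
      rw [← hm]; rfl
    rw [h1, h2, hQ]
  obtain ⟨c₂, hc₂⟩ := ContH1.exists_coboundary_of_mk_eq r (g₁ * g₂⁻¹) hQ'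
  refine ⟨b, kk, m, c₂ * c₁ * (MulAut.conjNormal (D.toTheta (x : D.PiTemp)) c₁)⁻¹, hm, fun k => ?_⟩
  -- notation for the images in `(Π^tp_X)^Θ`
  set xb := D.toTheta (x : D.PiTemp) with hxb
  set kb := D.toTheta (k : D.PiTemp) with hkb
  -- `(xσ)·f₀` at `k` is `x̄ · (σ·f₀)(x⁻¹ k x) · x̄⁻¹`
  have hk2 : (g₂.1 ⟨k, k.2.1⟩ : D.DeltaTheta) =
      MulAut.conjNormal xb (g₁.1 ⟨(x : D.PiTemp)⁻¹ * k * x, C.inv_mul_mul_mem_GtpYdd hC x k⟩) := by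
    rw [hg₂, ContH1.conjCocycle_mul]
    exact ContH1.conjCocycle_apply_eq _ g₁ _ _ rfl
  -- unfold the values of `f` and of `x·f`
  have hfk : f.1 k = g₁.1 ⟨k, k.2.1⟩ * (MulAut.conjNormal kb c₁ * c₁⁻¹) := hσ k
  have hxfk : MulAut.conjNormal xb (f.1 ⟨(x : D.PiTemp)⁻¹ * k * x, C.inv_mul_mul_mem_GtpYdduu hC x k⟩) =
      g₂.1 ⟨k, k.2.1⟩ * (MulAut.conjNormal kb (MulAut.conjNormal xb c₁) * (MulAut.conjNormal xb c₁)⁻¹) := by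
    rw [hσ ⟨_, C.inv_mul_mul_mem_GtpYdduu hC x k⟩, map_mul, hk2]
    congr 1
    have : D.toTheta (((⟨_, C.inv_mul_mul_mem_GtpYdduu hC x k⟩ : C.GtpYdduu) : D.PiTemp)) =
        xb⁻¹ * kb * xb := by
      change D.toTheta ((x : D.PiTemp)⁻¹ * k * x) = _
      rw [map_mul, map_mul, map_inv]
    rw [this]
    exact conjNormal_cob xb kb c₁
  -- the coboundary identity `hc₂` at `k`
  have hk : (g₁ * g₂⁻¹).1 ⟨k, k.2.1⟩ = r.1 ⟨k, k.2.1⟩ * (MulAut.conjNormal kb c₂ * c₂⁻¹) := hc₂ ⟨k, k.2.1⟩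
  have hr' : r.1 ⟨k, k.2.1⟩ = m.1 ⟨D.toTheta (k : D.PiTemp), ⟨k, D.GtpYdd_le_GtpY k.2.1, rfl⟩⟩ := rfl
  have hgg : (g₁ * g₂⁻¹).1 ⟨k, k.2.1⟩ = g₁.1 ⟨k, k.2.1⟩ * (g₂.1 ⟨k, k.2.1⟩)⁻¹ := rfl
  rw [hfk, hxfk, ← hr', cob_mul, cob_mul, cob_inv]
  rw [hgg] at hk
  -- commutative-group bookkeeping in `Δ_Θ`
  apply (Additive.ofMul : D.DeltaTheta ≃ _).injective
  have hk' := congrArg (Additive.ofMul : D.DeltaTheta ≃ _) hk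
  simp only [ofMul_mul, ofMul_inv, mul_inv] at hk' ⊢
  rw [← sub_eq_zero] at hk' ⊢
  rw [← hk']
  abel

/-! ## `l·Δ_Θ`-valuedness on `Π^tp_Y̲̲` -/

/-- Every `g ∈ Π^tp_Y̲̲` is `d · k` with `k ∈ Π^tp_Ÿ̲̲` and `d ∈ Δ^tp_Y̲̲` (`Π^tp_Ÿ̲̲ ↠ G_K`, `map_aug_Ydduu`).
[cite: MochizukiEtTh2009, Prop 2.2 (iii) p.37] -/
theorem exists_delta_mul (g : D.GtpY.subgroupOf C.Huu) :
    ∃ (k : D.GtpYdd.subgroupOf C.Huu) (d : D.GtpY.subgroupOf C.Huu),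
      D.aug.toMonoidHom ((d : C.Huu) : D.PiTemp) = 1 ∧
      g = d * Subgroup.inclusion (H := D.GtpYdd.subgroupOf C.Huu) (K := D.GtpY.subgroupOf C.Huu)
        (Subgroup.comap_mono D.GtpYdd_le_GtpY) k := by
  have hmem : D.aug.toMonoidHom ((g : C.Huu) : D.PiTemp) ∈ (D.GtpYdd ⊓ C.Huu).map D.aug.toMonoidHom := by
    rw [C.map_aug_Ydduu]; exact D.aug_mem_GK _
  obtain ⟨k₀, hk₀mem, hk₀'⟩ := hmem
  set k : D.GtpYdd.subgroupOf C.Huu := ⟨⟨k₀, hk₀mem.2⟩, hk₀mem.1⟩ with hkdef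
  refine ⟨k, g * (Subgroup.inclusion (H := D.GtpYdd.subgroupOf C.Huu) (K := D.GtpY.subgroupOf C.Huu)
    (Subgroup.comap_mono D.GtpYdd_le_GtpY) k)⁻¹, ?_, ?_⟩
  · change D.aug.toMonoidHom (((g : C.Huu) : D.PiTemp) * k₀⁻¹) = 1
    rw [map_mul, map_inv, hk₀', mul_inv_cancel]
  · rw [inv_mul_cancel_right]

/-- `g² ∈ Π^tp_Ÿ̲̲` for `g ∈ Π^tp_Y̲̲` (`[Π^tp_Y̲̲ : Π^tp_Ÿ̲̲] = 2`). [cite: MochizukiEtTh2009, Def 2.7 p.41] -/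
theorem mul_self_mem_GtpYdd (hC : D.Compat) (hS : D.Sec2Hyps) {N : ℕ+} (μ : D.CyclotomeMod l N)
    (g : D.GtpY.subgroupOf C.Huu) : (((g * g : D.GtpY.subgroupOf C.Huu) : C.Huu) : D.PiTemp) ∈ D.GtpYdd :=
  Subgroup.mul_self_mem_of_index_two (C.thetaEnvData μ hC hS).index_PiYdd g

/-- **`l·Δ_Θ`-valuedness propagates from `Π^tp_Ÿ̲̲` to `Π^tp_Y̲̲`**: a continuous `Δ_Θ`-valued cocycle `F` on
`Π^tp_Y̲̲` whose values on `Π^tp_Ÿ̲̲` lie in `l·Δ_Θ` is `l·Δ_Θ`-valued — write `g = d·k`, `d ∈ Δ^tp_Y̲̲`,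
`k ∈ Π^tp_Ÿ̲̲`; `F(d)² = F(d²) ∈ l·Δ_Θ` (`Δ_Θ` central in `(Δ^tp_X)^Θ`, `d² ∈ Π^tp_Ÿ̲̲`), `F(d)^l ∈ l·Δ_Θ`, and
`l` is odd. [cite: MochizukiEtTh2009, Prop 2.14(ii) p.49] -/
theorem lDelta_valued_of_restrict (hC : D.Compat) (hS : D.Sec2Hyps) {N : ℕ+} (μ : D.CyclotomeMod l N)
    (F : contCocycles (D.toTheta.comp C.Huu.subtype) D.DeltaTheta (D.GtpY.subgroupOf C.Huu))
    (hF : ∀ k : D.GtpYdd.subgroupOf C.Huu,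
      (F.1 (Subgroup.inclusion (H := D.GtpYdd.subgroupOf C.Huu) (K := D.GtpY.subgroupOf C.Huu)
        (Subgroup.comap_mono D.GtpYdd_le_GtpY) k) : D.GtpTheta) ∈ D.lDeltaTheta l)
    (g : D.GtpY.subgroupOf C.Huu) : (F.1 g : D.GtpTheta) ∈ D.lDeltaTheta l := by
  obtain ⟨k, d, hd, rfl⟩ := C.exists_delta_mul g
  rw [F.2.2]
  refine mul_mem ?_ ((D.lDeltaTheta_normal l).conj_mem _ (hF k) _)
  -- `F(d) ∈ l·Δ_Θ`
  have hsq : (F.1 d : D.GtpTheta) ^ 2 ∈ D.lDeltaTheta l := by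
    have h2 := F.2.2 d d
    have hcen : MulAut.conjNormal ((D.toTheta.comp C.Huu.subtype) (d : C.Huu)) (F.1 d) = F.1 d :=
      conjNormal_eq_of_aug_eq_one hd _
    rw [hcen] at h2
    set kdd : D.GtpYdd.subgroupOf C.Huu :=
      ⟨((d * d : D.GtpY.subgroupOf C.Huu) : C.Huu), C.mul_self_mem_GtpYdd hC hS μ d⟩ with hkdd
    have hdd := hF kdd
    have : Subgroup.inclusion (H := D.GtpYdd.subgroupOf C.Huu) (K := D.GtpY.subgroupOf C.Huu)
        (Subgroup.comap_mono D.GtpYdd_le_GtpY) kdd = d * d := rfl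
    rw [this, h2, Subgroup.coe_mul, ← pow_two] at hdd
    exact hdd
  have hl : (F.1 d : D.GtpTheta) ^ l ∈ D.lDeltaTheta l := ⟨(F.1 d : D.GtpTheta), (F.1 d).2, rfl⟩
  obtain ⟨n, hn⟩ := C.l_odd
  have hl' : (F.1 d : D.GtpTheta) ^ (2 * n + 1) ∈ D.lDeltaTheta l := by rw [← hn]; exact hl
  have key : ∀ t : D.GtpTheta, t = t ^ (2 * n + 1) * (t ^ 2)⁻¹ ^ n := fun t => by
    rw [inv_pow, ← pow_mul, pow_succ', mul_inv_cancel_right]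
  rw [key (F.1 d : D.GtpTheta)]
  exact mul_mem hl' (pow_mem (inv_mem hsq) n)

/-! ## The conjugates of the extension by `Π^tp_X̲̲` -/

/-- For a continuous cocycle `F` on `Π^tp_Y̲̲` and `y ∈ Π^tp_X̲̲`, the cocycle `(y·F)·F⁻¹` is multiplicative on
`Δ^tp_Y̲̲` (cocycle identity + `Δ_Θ` central in `(Δ^tp_X)^Θ`): its value at `d²` is the square of its value
at `d`. [cite: MochizukiEtTh2009, Prop 2.14(ii) p.49] -/
theorem cocycle_apply_mul_self_of_aug_eq_one
    (ψ : contCocycles (D.toTheta.comp C.Huu.subtype) D.DeltaTheta (D.GtpY.subgroupOf C.Huu))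
    (d : D.GtpY.subgroupOf C.Huu) (hd : D.aug.toMonoidHom ((d : C.Huu) : D.PiTemp) = 1) :
    ψ.1 (d * d) = ψ.1 d * ψ.1 d := by
  rw [ψ.2.2]
  change ψ.1 d * MulAut.conjNormal (D.toTheta ((d : C.Huu) : D.PiTemp)) (ψ.1 d) = _
  rw [conjNormal_eq_of_aug_eq_one hd]

/-- `Π^tp_X̲̲ → (Π^tp_X)^Θ` (restriction of the theta quotient) is continuous.
[cite: MochizukiEtTh2009, §1 p.12] -/
theorem continuous_toTheta_comp_subtype : Continuous (D.toTheta.comp C.Huu.subtype) :=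
  D.continuous_toTheta.comp continuous_subtype_val

/-- **"`Gal(Y/X)` maps `Ü²` to a `K^×`-multiple of `Ü²`"** at the cocycle level: for a descended
extension `F = m(·̄)·∂e(·̄)` on `Π^tp_Y̲̲` (with `[m] = b·log(U) + log(k)`, cf. `exists_descended_rep`) and
`y ∈ Π^tp_X̲̲`, the cocycle `(y·F)·F⁻¹` VANISHES at every `d ∈ Δ^tp_Ÿ̲̲` — its value there is a coboundary
value at `d̄ ∈ (Δ^tp_Ÿ)^Θ` of the class `y·[m] − [m]`, which vanishes on `(Δ^tp_Ÿ)^Θ` by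
`res_conj_descended_div_eq_one` (Prop 1.5 (ii), (iii)). [cite: MochizukiEtTh2009, Prop 2.14(ii) p.49] -/
theorem conjDiff_apply_eq_one_of_mem (hC : D.Compat) (h15 : Prop15iii E hC)
    (h15ii : Prop15ii E.toKummerData hC) (b : ℤ) (kk : E.KHat)
    (m : contCocycles (MonoidHom.id D.GtpTheta) D.DeltaTheta (D.GtpY.map D.toTheta))
    (hm : (QuotientGroup.mk m : D.H1Theta (D.GtpY.map D.toTheta)) = E.logU ^ b * E.kumY kk)
    (e : D.DeltaTheta)
    (F : contCocycles (D.toTheta.comp C.Huu.subtype) D.DeltaTheta (D.GtpY.subgroupOf C.Huu))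
    (hFm : ∀ g : D.GtpY.subgroupOf C.Huu, F.1 g =
      m.1 ⟨D.toTheta ((g : C.Huu) : D.PiTemp), C.map_GtpYuu_le ⟨(g : C.Huu), g.2, rfl⟩⟩ *
        (MulAut.conjNormal (D.toTheta ((g : C.Huu) : D.PiTemp)) e * e⁻¹))
    (y : C.Huu) (d : D.GtpY.subgroupOf C.Huu)
    (hd : D.aug.toMonoidHom ((d : C.Huu) : D.PiTemp) = 1) (hdd : ((d : C.Huu) : D.PiTemp) ∈ D.GtpYdd) :
    haveI := C.GtpYuu_normal
    (ContH1.conjCocycle (D.toTheta.comp C.Huu.subtype) D.DeltaTheta y F * F⁻¹).1 d = 1 := by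
  haveI := C.GtpYuu_normal
  haveI : (D.GtpY.map D.toTheta).Normal := GtpYTheta_normal
  -- the conjugated point `y⁻¹ d y` is again in `Δ^tp_X`
  set d' : D.GtpY.subgroupOf C.Huu := ⟨y⁻¹ * (d : C.Huu) * y,
    (C.GtpYuu_normal).conj_mem' _ d.2 y⟩ with hd'
  have hd'v : ((d' : C.Huu) : D.PiTemp) = (y : D.PiTemp)⁻¹ * ((d : C.Huu) : D.PiTemp) * y := rfl
  have hyd : D.aug.toMonoidHom ((d' : C.Huu) : D.PiTemp) = 1 := by
    rw [hd'v, map_mul, map_mul, hd, mul_one, map_inv, inv_mul_cancel]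
  -- value of `(y·F)·F⁻¹` at `d`, with the coboundary parts gone
  have step : (ContH1.conjCocycle (D.toTheta.comp C.Huu.subtype) D.DeltaTheta y F * F⁻¹).1 d =
      MulAut.conjNormal (D.toTheta (y : D.PiTemp))
          (m.1 ⟨D.toTheta ((d' : C.Huu) : D.PiTemp), C.map_GtpYuu_le ⟨(d' : C.Huu), d'.2, rfl⟩⟩) *
        (m.1 ⟨D.toTheta ((d : C.Huu) : D.PiTemp), C.map_GtpYuu_le ⟨(d : C.Huu), d.2, rfl⟩⟩)⁻¹ := by
    change (ContH1.conjCocycle (D.toTheta.comp C.Huu.subtype) D.DeltaTheta y F).1 d * (F.1 d)⁻¹ = _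
    rw [ContH1.conjCocycle_apply_eq (y : C.Huu) F d d' rfl, hFm d', hFm d,
      cob_eq_one_of_aug_eq_one hyd, cob_eq_one_of_aug_eq_one hd, mul_one, mul_one]
    rfl
  rw [step]
  -- the point `ȳ⁻¹ d̄ ȳ` of `(Π^tp_Y)^Θ`
  have hpt : ((⟨D.toTheta ((d' : C.Huu) : D.PiTemp), C.map_GtpYuu_le ⟨(d' : C.Huu), d'.2, rfl⟩⟩ :
      D.GtpY.map D.toTheta) : D.GtpTheta) =
      (D.toTheta (y : D.PiTemp))⁻¹ * ((⟨D.toTheta ((d : C.Huu) : D.PiTemp),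
        C.map_GtpYuu_le ⟨(d : C.Huu), d.2, rfl⟩⟩ : D.GtpY.map D.toTheta) : D.GtpTheta) *
        D.toTheta (y : D.PiTemp) := by
    change D.toTheta ((d' : C.Huu) : D.PiTemp) = _
    rw [hd'v, map_mul, map_mul, map_inv]
  have happ := ContH1.conjCocycle_apply_eq (φ := MonoidHom.id D.GtpTheta) (D.toTheta (y : D.PiTemp)) m _ _ hpt
  rw [MonoidHom.id_apply] at happ
  rw [← happ]
  -- the class `ȳ·[m] − [m]` vanishes on `(Δ^tp_Ÿ)^Θ`, so the cocycle is a coboundary there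
  have hB : (D.DtpYddN 1).map D.toTheta ≤ D.GtpY.map D.toTheta :=
    (Subgroup.map_mono inf_le_left : (D.DtpYddN 1).map D.toTheta ≤ D.GtpYdd.map D.toTheta).trans
      D.GtpYddTheta_le
  have hcl : (QuotientGroup.mk (ContH1.resCocycle (MonoidHom.id D.GtpTheta) D.DeltaTheta hB
      (ContH1.conjCocycle (MonoidHom.id D.GtpTheta) D.DeltaTheta (D.toTheta (y : D.PiTemp)) m * m⁻¹)) :
        D.H1Theta ((D.DtpYddN 1).map D.toTheta)) = QuotientGroup.mk 1 := by
    have := E.res_conj_descended_div_eq_one hC h15 h15ii ((y : C.Huu) : D.PiTemp) b kk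
    rw [← hm] at this
    exact this
  obtain ⟨a, ha⟩ := ContH1.exists_coboundary_of_mk_eq _ _ hcl.symm
  have hdB : D.toTheta ((d : C.Huu) : D.PiTemp) ∈ (D.DtpYddN 1).map D.toTheta :=
    ⟨((d : C.Huu) : D.PiTemp), ⟨hdd, hd⟩, rfl⟩
  have hval' : (ContH1.conjCocycle (MonoidHom.id D.GtpTheta) D.DeltaTheta (D.toTheta (y : D.PiTemp)) m).1
      ⟨D.toTheta ((d : C.Huu) : D.PiTemp), hB hdB⟩ * (m.1 ⟨D.toTheta ((d : C.Huu) : D.PiTemp), hB hdB⟩)⁻¹ =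
      1 * (MulAut.conjNormal (MonoidHom.id D.GtpTheta (D.toTheta ((d : C.Huu) : D.PiTemp))) a * a⁻¹) :=
    ha ⟨D.toTheta ((d : C.Huu) : D.PiTemp), hdB⟩
  rw [MonoidHom.id_apply, cob_eq_one_of_aug_eq_one hd a, one_mul] at hval'
  exact hval'

end EtaleThetaData.DoubleUnderline

end ThetaSetting

end Literature.AnabelianGeometry.EtaleTheta

end
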